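import Literature.MathematicalPhysics.QuantumFieldTheory.Balaban1983to89.B9Eq347LocalLetterAdjoint
import Literature.MathematicalPhysics.QuantumFieldTheory.Balaban1983to89.B9Eq315QLocalLetter
import Literature.MathematicalPhysics.QuantumFieldTheory.Balaban1983to89.B9Eq315QkLocalLetter
import Literature.MathematicalPhysics.QuantumFieldTheory.Balaban1983to89.B9Eq349ConjugatedQTowerLetterLinear

/-!
# `Balaban1983to89.B9Eq315QAdjointBlockDecay` — T. Bałaban, *Propagators for lattice gauge theories in a background field*, Commun. Math. Phys. **99** (1985)
# 389–434 [Balaban1985BackgroundPropagators] (3.15)∕(3.16) p. 393, Thm 3.1 (3.42) p. 397, (3.49) p. 399, p. 391 («the adjoints are taken with respect to natural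
# L² scalar products»), with [Balaban1985Averaging] (126) p. 36: **THE `Q†` LETTER OF THE `H₁` ROW INHABITED FOR THE CHAIN's AVERAGING — `‖P_v ∘ Q(U)† ∘ r_u‖ ≤
# M_φ′M_φ(1 + 50(d+1)α)·e^{κ}·√(d·c₁∕c₀)·e^{−κ·d_m(u,v)}` (one step, `Q(U) = B9Eq315QTorus.QtorusW`) and `‖P_v ∘ Q_k(U)† ∘ r_u‖ ≤
# M_φ′M_φ·Π_{j≤n}(1 + 50(d+1)α_j)·e^{κ}·√(d·c₁∕c₀)·e^{−κ·d_m(u,v)}` (tower, `Q_k(U) = B9Eq326OperatorTower.QkW`, every height), for EVERY `κ ≥ 0`** — the local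
# letters `B9Eq315QLocalLetter.local_QtorusW` ∕ `B9Eq315QkLocalLetter.local_QkW` (range one block, [B7] (126)) turned into `L²` block decay by
# `B9Eq347LocalLetterAdjoint.block_decay_of_local` and transported to the adjoint by `opNorm_block_adjoint_block`, the block families' self-adjointness and
# `toCLM(Q†) = toCLM(Q)†` PROVED here from the pointwise characterisations — the displayed hypothesis `hQa` of `B9Eq3126H1BlockDecay(OfLetters)` ∕
# `B9Eq3126H1BlockDecay(OfLetters)Tower` at the chain's `Q`, constant explicit in `M_φ, M_φ′, α, d, c₀, c₁` and ANY rate `κ` (a local operator decays at every rate)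

statement-level skeleton of published theorems with citation tags; proofs where landed; nothing here is a claim about the Yang–Mills mass gap

CITATION HEADER (lean-in-tree rule).  Audit cell `pub-balaban`, sub-cell `t4`, BINDER row NE9 (road ΔA-CT of the NE9 formalisation swarm, leaf prover 03
`b2b-balaban-t4-ne9-formalise-leaf-03` gen 76).  Imports this lineage's (K2) `B9Eq347LocalLetterAdjoint` (`block_decay_of_local`, `opNorm_block_adjoint_block`),
(QL) `B9Eq315QLocalLetter` (`local_QtorusW`), (QK) `B9Eq315QkLocalLetter` (`local_QkW`), (TLW) `B9Eq349ConjugatedQTowerLetterLinear`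
(`prod_one_add_le_exp_sum`, for the height-free form).  Sources READ first-hand: [Balaban1985BackgroundPropagators] p. 393
(3.15)∕(3.16), p. 397 Thm 3.1 (3.42), p. 399 (3.49), p. 391; [Balaban1985Averaging] p. 36 (126).  Nothing of print's rates asserted: a range-one operator decays at
every rate `κ` with the honest price `e^{κ}`.

WHAT IS PROVED (sorry-free; proof lane — no `def`; [folklore] `L²` bookkeeping BY NAME).
* §1 (generic weighted `L²`) `adjoint_block_eq` (a block family given by a pointwise indicator is SELF-ADJOINT), `toCLM_adjoint_eq` (`toCLM(Q†) = (toCLM Q)†`),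
  `sum_ite_bpos_const` (`Σ_{b′: b′₋ = u} c₁ = d·c₁` on `Bond = TSite × Fin d`).
* §2 one step: **`norm_block_QtorusW_le`** (`‖r_u ∘ Q(U) ∘ P_v‖`), **`norm_block_adjoint_QtorusW_le`** (`‖P_v ∘ Q(U)† ∘ r_u‖`) — the `hQa` of `B9Eq3126H1BlockDecay`.
* §3 tower: **`norm_block_QkW_le`**, **`norm_block_adjoint_QkW_le`** — the `hQa` of `B9Eq3126H1BlockDecayTower`, every height `n`; `prod_level_le_exp` and
  **`norm_block_adjoint_QkW_le_heightFree`** — under `Σ_{j≤n} α_j ≤ A` the constant is `M_φ′M_φ·e^{50(d+1)A}·e^{κ}·√(d·c₁∕c₀)`, THE SAME AT EVERY HEIGHT (`∃` before `n`).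
HONEST SCOPE.  The chain's `Q` only (per-level small-field regime `α ≤ 1∕64`, unit-ball backgrounds — the letters of `QtorusW`∕`QkW`); constants symbolic; no
number; NOT NE9 (cell pub-balaban: NE9 NOT PRINTED ∕ NOT PROVED; «NE9 ⇐ the named binders»; row WALLED ON A MODEL (O-NE9-1; #5 UNRULED); spine PROVED 0∕9; rung
(B)+1 on a finite T⁴ — NOT infinite volume, NOT mass gap, NOT BetaPertH, NOT Clay; HONEST DEPENDENCY: continuum YM on T⁴ ⇐ BetaPertH ∧ nine spine estimates (0/9
proved); BetaPertH ⇐ (D1) ∧ (D4) ∧ CAP+tail).  NEW file; nothing modified.  Net new unproved facts: 0.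
-/

noncomputable section

open scoped InnerProductSpace ComplexConjugate BigOperators

namespace Literature.MathematicalPhysics.QuantumFieldTheory.Balaban1983to89.B9Eq315QAdjointBlockDecay

open B4Sect5Torus (TSite tdist tdist_symm)
open B9SectCLatticeCarrier (Bond bpos)
open B7Prop1Explicit (U1 Wcx boxVec)
open B9Eq311L2Pairing (WL2)
open B11Eq103H1Complex (BondL2K)
open B9Eq319QprimeTorus (fineP blockCoord)
open B9Eq315QTorus (perCfg cornerSite QtorusW)
open B9Eq315QTower (towerP)
open B9Eq316TowerFlatIsOneStep (siteCast towerP_eq_fineP_pow)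
open B9Eq326OperatorTower (QkW)
open B9Eq347LocalLetterAdjoint (block_decay_of_local opNorm_block_adjoint_block)
open B9Eq315QLocalLetter (local_QtorusW)
open B9Eq315QkLocalLetter (local_QkW)
open B9Eq349ConjugatedQTowerLetterLinear (prod_one_add_le_exp_sum)

/-! ## §1 Generic: indicator block families are self-adjoint; `toCLM` commutes with the adjoint; the coarse-bond point mass -/

section Generic

variable {𝕜 : Type*} [RCLike 𝕜] {X Y : Type*} [Fintype X] [DecidableEq Y] {w : X → ℝ} [Fact (∀ x, 0 < w x)]
  {V : Type*} [NormedAddCommGroup V] [InnerProductSpace 𝕜 V] [FiniteDimensional 𝕜 V]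
  {π : X → Y} {P : Y → WL2 𝕜 w V →L[𝕜] WL2 𝕜 w V}
  (hP : ∀ (y : Y) (f : WL2 𝕜 w V) (x : X), WL2.equiv 𝕜 w V (P y f) x = if π x = y then WL2.equiv 𝕜 w V f x else 0)

include hP in
/-- **AN INDICATOR BLOCK FAMILY IS SELF-ADJOINT** in the weighted `L²` space: `(P_y)† = P_y` (both sides of `⟪P_y f, g⟫ = ⟪f, P_y g⟫` are
`Σ_{π x = y} w(x)⟪f(x), g(x)⟫`). [folklore] [cite: Balaban1985BackgroundPropagators, p.391, (3.11) p.392, (3.49) p.399] -/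
theorem adjoint_block_eq (y : Y) : ContinuousLinearMap.adjoint (P y) = P y := by
  symm
  rw [ContinuousLinearMap.eq_adjoint_iff]
  intro f g
  rw [WL2.inner_def, WL2.inner_def]
  refine Finset.sum_congr rfl fun x _ => ?_
  rw [hP, hP]
  by_cases h : π x = y
  · simp [h]
  · simp [h]

omit [DecidableEq Y] [Fact (∀ x, 0 < w x)] in
/-- `toCLM` COMMUTES WITH THE ADJOINT between weighted `L²` spaces: `toCLM(Q†) = (toCLM Q)†` (both are characterised by `⟪Q†g, f⟫ = ⟪g, Qf⟫`). [folklore]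
[cite: Balaban1985BackgroundPropagators, p.391] -/
theorem toCLM_adjoint_eq {X' : Type*} [Fintype X'] {w' : X' → ℝ} [Fact (∀ x, 0 < w x)] [Fact (∀ x, 0 < w' x)]
    {V' : Type*} [NormedAddCommGroup V'] [InnerProductSpace 𝕜 V'] [FiniteDimensional 𝕜 V'] (Q : WL2 𝕜 w V →ₗ[𝕜] WL2 𝕜 w' V') :
    LinearMap.toContinuousLinearMap (LinearMap.adjoint Q) = ContinuousLinearMap.adjoint (LinearMap.toContinuousLinearMap Q) := by
  rw [ContinuousLinearMap.eq_adjoint_iff]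
  intro g f
  simp only [LinearMap.coe_toContinuousLinearMap']
  exact LinearMap.adjoint_inner_left Q f g

/-- the coarse-bond point mass: `Σ_{b′ : b′₋ = u} c₁ = d·c₁` (`Bond d m = TSite d m × Fin d`, `b′₋ = b′.1`). [folklore] [cite: Balaban1985BackgroundPropagators, (3.11) p.392] -/
theorem sum_ite_bpos_const {d : ℕ} {m : Fin d → ℕ} (c₁ : ℝ) (u : TSite d m) :
    ∑ b' : Bond d m, (if bpos b' = u then c₁ else 0) = d * c₁ := by
  classical
  rw [Fintype.sum_prod_type, Finset.sum_comm]
  simp only [bpos, Finset.sum_ite_eq', Finset.mem_univ, if_true, Finset.sum_const, Finset.card_univ, Fintype.card_fin, nsmul_eq_mul]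

end Generic

/-! ## §2 One step: the block decay of `Q(U)` and of `Q(U)†` -/

section OneStep

variable {d : ℕ} (L : ℕ) [NeZero L] (m : Fin d → ℕ) [∀ i, NeZero (m i)] [∀ i, NeZero (fineP L m i)]
  {𝔸 : Type*} [NormedRing 𝔸] [NormedAlgebra ℂ 𝔸] [CompleteSpace 𝔸] [NormOneClass 𝔸] (hL : 1 ≤ L)
  (U : Bond d (fineP L m) → 𝔸ˣ) {α : ℝ} (hα1 : α ≤ 1 / 64)
  (hU1 : ∀ (x : B7Prop1Explicit.Site d) (κ : Fin d), perCfg (fineP L m) U x κ ∈ U1 𝔸)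
  (hreg : ∀ (y : TSite d m) (κ : Fin d) (r : Fin d → Fin L),
    ‖((Wcx L (perCfg (fineP L m) U) (cornerSite L y) κ (boxVec L r) : 𝔸ˣ) : 𝔸) - 1‖ ≤ α)
  {W : Type*} [NormedAddCommGroup W] [InnerProductSpace ℂ W] [FiniteDimensional ℂ W] (φ : W ≃ₗ[ℂ] 𝔸) {c₀ c₁ : ℝ} [Fact (0 < c₀)] [Fact (0 < c₁)]
  {Mφ Mφ' : ℝ} (hφ : ∀ w, ‖φ w‖ ≤ Mφ * ‖w‖) (hφ' : ∀ X, ‖φ.symm X‖ ≤ Mφ' * ‖X‖) (hMφ : 0 ≤ Mφ) (hMφ' : 0 ≤ Mφ')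
  {PB : TSite d m → BondL2K ℂ d (fineP L m) c₀ W →L[ℂ] BondL2K ℂ d (fineP L m) c₀ W}
  (hPB : ∀ (y : TSite d m) (f : BondL2K ℂ d (fineP L m) c₀ W) (b : Bond d (fineP L m)),
    WL2.equiv ℂ (fun _ : Bond d (fineP L m) => c₀) W (PB y f) b =
      if blockCoord L m (bpos b) = y then WL2.equiv ℂ (fun _ : Bond d (fineP L m) => c₀) W f b else 0)
  {rF : TSite d m → BondL2K ℂ d m c₁ W →L[ℂ] BondL2K ℂ d m c₁ W}
  (hrF : ∀ (y : TSite d m) (g : BondL2K ℂ d m c₁ W) (b' : Bond d m),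
    WL2.equiv ℂ (fun _ : Bond d m => c₁) W (rF y g) b' = if bpos b' = y then WL2.equiv ℂ (fun _ : Bond d m => c₁) W g b' else 0)

include hφ hφ' hMφ hMφ' hPB hrF in
/-- **THE `L²` BLOCK DECAY OF THE CHAIN's `Q(U)`**: `‖r_u ∘ Q(U) ∘ P_v‖ ≤ M_φ′M_φ(1 + 50(d+1)α)·e^{κ}·√(d·c₁)∕√c₀·e^{−κ·d_m(u,v)}` for every `κ ≥ 0` —
`block_decay_of_local` at the local letter `local_QtorusW` (source weights `= c₀`, coarse point mass `d·c₁`). [folklore]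
[cite: Balaban1985BackgroundPropagators, (3.15) p.393, Thm 3.1 (3.42) p.397, (3.49) p.399; Balaban1985Averaging, (126) p.36] -/
theorem norm_block_QtorusW_le (hm : ∀ i, 1 ≤ m i) {κ : ℝ} (hκ : 0 ≤ κ) (hα0 : 0 ≤ α) (u v : TSite d m) :
    ‖rF u ∘L LinearMap.toContinuousLinearMap (QtorusW L m hL φ U hα1 hU1 hreg (c₀ := c₀) (c₁ := c₁)) ∘L PB v‖ ≤
      Mφ' * Mφ * (1 + 50 * (d + 1) * α) * Real.exp κ * Real.sqrt (d * c₁) / Real.sqrt c₀ * Real.exp (-(κ * tdist m u v)) := by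
  have hc₀ : 0 < c₀ := Fact.out
  have hB : 0 ≤ Mφ' * Mφ * (1 + 50 * (d + 1) * α) * Real.exp κ := by positivity
  have hμ' : ∀ a : TSite d m, ∑ b' : Bond d m, (if bpos b' = a then c₁ else 0) ≤ d * c₁ := fun a => (sum_ite_bpos_const c₁ a).le
  exact block_decay_of_local hPB hrF (LinearMap.toContinuousLinearMap (QtorusW L m hL φ U hα1 hU1 hreg (c₀ := c₀) (c₁ := c₁))) (tdist m) hB hc₀
    (fun _ => le_rfl) hμ'
    (fun v f F hfv hfF c => by
      rw [LinearMap.coe_toContinuousLinearMap']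
      exact local_QtorusW L m hL U hα1 hU1 hreg φ hφ hφ' hMφ hMφ' hm hκ v f F hfv hfF c) u v

include hφ hφ' hMφ hMφ' hPB hrF in
/-- **THE `Q†` LETTER `hQa` OF THE `H₁` ROW, INHABITED**: `‖P_v ∘ Q(U)† ∘ r_u‖ ≤ M_φ′M_φ(1 + 50(d+1)α)·e^{κ}·√(d·c₁)∕√c₀·e^{−κ·d_m(u,v)}` for every `κ ≥ 0` —
the previous bound transported by `(r_uQP_v)† = P_vQ†r_u` (self-adjoint families, §1) and the symmetry of `d_m`; the shape of `B9Eq3126H1BlockDecayOfLetters`'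
`hQa` ∕ `B9Eq3126H1BlockDecay`'s `hQa` at `Q := QtorusW …`. [folklore] [cite: Balaban1985BackgroundPropagators, p.391, (3.15) p.393, Thm 3.1 (3.42) p.397, (3.49) p.399] -/
theorem norm_block_adjoint_QtorusW_le (hm : ∀ i, 1 ≤ m i) {κ : ℝ} (hκ : 0 ≤ κ) (hα0 : 0 ≤ α) (u v : TSite d m) :
    ‖PB v ∘L LinearMap.toContinuousLinearMap (LinearMap.adjoint (QtorusW L m hL φ U hα1 hU1 hreg (c₀ := c₀) (c₁ := c₁))) ∘L rF u‖ ≤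
      Mφ' * Mφ * (1 + 50 * (d + 1) * α) * Real.exp κ * Real.sqrt (d * c₁) / Real.sqrt c₀ * Real.exp (-(κ * tdist m u v)) := by
  rw [toCLM_adjoint_eq, opNorm_block_adjoint_block _ (adjoint_block_eq hPB) (adjoint_block_eq hrF)]
  exact norm_block_QtorusW_le L m hL U hα1 hU1 hreg φ hφ hφ' hMφ hMφ' hPB hrF hm hκ hα0 u v

end OneStep

/-! ## §3 The tower: the block decay of `Q_k(U)` and of `Q_k(U)†`, every height -/

section Tower

variable {d : ℕ} (L : ℕ) [NeZero L] (m : Fin d → ℕ) [∀ i, NeZero (m i)] (n : ℕ)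
  {𝔸 : Type*} [NormedRing 𝔸] [NormedAlgebra ℂ 𝔸] [CompleteSpace 𝔸] [NormOneClass 𝔸]
  {W : Type*} [NormedAddCommGroup W] [InnerProductSpace ℂ W] [FiniteDimensional ℂ W] (φ : W ≃ₗ[ℂ] 𝔸) {c₀ c₁ : ℝ} [Fact (0 < c₀)] [Fact (0 < c₁)]
  (U : Bond d (towerP L m (n + 1)) → 𝔸ˣ) (hL : 1 ≤ L) (α : ℕ → ℝ) (hα1 : ∀ j, α j ≤ 1 / 64)
  (hU1 : ∀ (j : ℕ) (x : B7Prop1Explicit.Site d) (κ : Fin d), perCfg (towerP L m (j + 1)) (B9Eq315QTower.UlevOf L m (n + 1) U j) x κ ∈ U1 𝔸)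
  (hreg : ∀ (j : ℕ) (y : TSite d (towerP L m j)) (κ : Fin d) (r : Fin d → Fin L),
    ‖((Wcx L (perCfg (towerP L m (j + 1)) (B9Eq315QTower.UlevOf L m (n + 1) U j)) (cornerSite L y) κ (boxVec L r) : 𝔸ˣ) : 𝔸) - 1‖ ≤ α j)
  {Mφ Mφ' : ℝ} (hφ : ∀ w, ‖φ w‖ ≤ Mφ * ‖w‖) (hφ' : ∀ X, ‖φ.symm X‖ ≤ Mφ' * ‖X‖) (hMφ : 0 ≤ Mφ) (hMφ' : 0 ≤ Mφ')
  {PB : TSite d m → BondL2K ℂ d (towerP L m (n + 1)) c₀ W →L[ℂ] BondL2K ℂ d (towerP L m (n + 1)) c₀ W}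
  (hPB : ∀ (y : TSite d m) (f : BondL2K ℂ d (towerP L m (n + 1)) c₀ W) (b : Bond d (towerP L m (n + 1))),
    WL2.equiv ℂ (fun _ : Bond d (towerP L m (n + 1)) => c₀) W (PB y f) b =
      if blockCoord (L ^ (n + 1)) m (siteCast (towerP_eq_fineP_pow L m (n + 1)) (bpos b)) = y then
        WL2.equiv ℂ (fun _ : Bond d (towerP L m (n + 1)) => c₀) W f b else 0)
  {rF : TSite d m → BondL2K ℂ d m c₁ W →L[ℂ] BondL2K ℂ d m c₁ W}
  (hrF : ∀ (y : TSite d m) (g : BondL2K ℂ d m c₁ W) (b' : Bond d m),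
    WL2.equiv ℂ (fun _ : Bond d m => c₁) W (rF y g) b' = if bpos b' = y then WL2.equiv ℂ (fun _ : Bond d m => c₁) W g b' else 0)

include hφ hφ' hMφ hMφ' hPB hrF in
/-- **THE `L²` BIG-BLOCK DECAY OF THE CHAIN's `Q_k(U)`, EVERY HEIGHT**: `‖r_u ∘ Q_k(U) ∘ P_v‖ ≤ M_φ′M_φ·Π_{j≤n}(1 + 50(d+1)α_j)·e^{κ}·√(d·c₁)∕√c₀·e^{−κ·d_m(u,v)}`
for every `κ ≥ 0` — `block_decay_of_local` at `local_QkW`. [folklore] [cite: Balaban1985BackgroundPropagators, (3.15)–(3.16) p.393, Thm 3.1 (3.42) p.397, (3.49) p.399; Balaban1985Averaging, (126) p.36] -/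
theorem norm_block_QkW_le (hm : ∀ i, 1 ≤ m i) {κ : ℝ} (hκ : 0 ≤ κ) (hα0 : ∀ j, 0 ≤ α j) (u v : TSite d m) :
    ‖rF u ∘L LinearMap.toContinuousLinearMap (QkW L m n φ U hL α hα1 hU1 hreg (c₀ := c₀) (c₁ := c₁)) ∘L PB v‖ ≤
      Mφ' * Mφ * (∏ j ∈ Finset.range (n + 1), (1 + 50 * (d + 1) * α j)) * Real.exp κ * Real.sqrt (d * c₁) / Real.sqrt c₀ *
        Real.exp (-(κ * tdist m u v)) := by
  have hc₀ : 0 < c₀ := Fact.out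
  have hprod : 0 ≤ ∏ j ∈ Finset.range (n + 1), (1 + 50 * (d + 1) * α j) := Finset.prod_nonneg fun j _ => by nlinarith [hα0 j]
  have hB : 0 ≤ Mφ' * Mφ * (∏ j ∈ Finset.range (n + 1), (1 + 50 * (d + 1) * α j)) * Real.exp κ := by positivity
  have hμ' : ∀ a : TSite d m, ∑ b' : Bond d m, (if bpos b' = a then c₁ else 0) ≤ d * c₁ := fun a => (sum_ite_bpos_const c₁ a).le
  exact block_decay_of_local hPB hrF (LinearMap.toContinuousLinearMap (QkW L m n φ U hL α hα1 hU1 hreg (c₀ := c₀) (c₁ := c₁))) (tdist m) hB hc₀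
    (fun _ => le_rfl) hμ'
    (fun v f F hfv hfF c => by
      rw [LinearMap.coe_toContinuousLinearMap']
      exact local_QkW L m n φ U hL α hα1 hU1 hreg hφ hφ' hMφ hMφ' hm hκ v f F hfv hfF c) u v

include hφ hφ' hMφ hMφ' hPB hrF in
/-- **THE `Q_k†` LETTER `hQa` OF THE TOWER `H₁` ROW, INHABITED, EVERY HEIGHT**: `‖P_v ∘ Q_k(U)† ∘ r_u‖ ≤ M_φ′M_φ·Π_{j≤n}(1 + 50(d+1)α_j)·e^{κ}·√(d·c₁)∕√c₀·e^{−κ·d_m(u,v)}`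
— the shape of `B9Eq3126H1BlockDecayOfLettersTower`'s ∕ `B9Eq3126H1BlockDecayTower`'s `hQa` at `Q_k := QkW …`. [folklore]
[cite: Balaban1985BackgroundPropagators, p.391, (3.15)–(3.16) p.393, Thm 3.1 (3.42) p.397, (3.49) p.399] -/
theorem norm_block_adjoint_QkW_le (hm : ∀ i, 1 ≤ m i) {κ : ℝ} (hκ : 0 ≤ κ) (hα0 : ∀ j, 0 ≤ α j) (u v : TSite d m) :
    ‖PB v ∘L LinearMap.toContinuousLinearMap (LinearMap.adjoint (QkW L m n φ U hL α hα1 hU1 hreg (c₀ := c₀) (c₁ := c₁))) ∘L rF u‖ ≤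
      Mφ' * Mφ * (∏ j ∈ Finset.range (n + 1), (1 + 50 * (d + 1) * α j)) * Real.exp κ * Real.sqrt (d * c₁) / Real.sqrt c₀ *
        Real.exp (-(κ * tdist m u v)) := by
  rw [toCLM_adjoint_eq, opNorm_block_adjoint_block _ (adjoint_block_eq hPB) (adjoint_block_eq hrF)]
  exact norm_block_QkW_le L m n φ U hL α hα1 hU1 hreg hφ hφ' hMφ hMφ' hPB hrF hm hκ hα0 u v

/-- the level product under a summable regime: `Π_{j≤n}(1 + 50(d+1)α_j) ≤ e^{50(d+1)A}` whenever `Σ_{j≤n} α_j ≤ A` (`1 + y ≤ e^y`, `B9Eq349ConjugatedQTowerLetterLinear`).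
[folklore] [cite: Balaban1985BackgroundPropagators, (3.16) p.393; Balaban1985Averaging, (126) p.36] -/
theorem prod_level_le_exp (hα0 : ∀ j, 0 ≤ α j) {A : ℝ} (hA : ∑ j ∈ Finset.range (n + 1), α j ≤ A) :
    ∏ j ∈ Finset.range (n + 1), (1 + 50 * (d + 1) * α j) ≤ Real.exp (50 * (d + 1) * A) := by
  have h1 := prod_one_add_le_exp_sum (Finset.range (n + 1)) (y := fun j => 50 * (d + 1) * α j) (fun j _ => by have := hα0 j; positivity)
  refine h1.trans (Real.exp_le_exp.mpr ?_)
  rw [← Finset.mul_sum]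
  exact mul_le_mul_of_nonneg_left hA (by positivity)

include hφ hφ' hMφ hMφ' hPB hrF in
/-- **THE `Q_k†` LETTER, HEIGHT-FREE**: in a summable per-level regime `Σ_{j≤n} α_j ≤ A`,
`‖P_v ∘ Q_k(U)† ∘ r_u‖ ≤ M_φ′M_φ·e^{50(d+1)A}·e^{κ}·√(d·c₁)∕√c₀·e^{−κ·d_m(u,v)}` — ONE constant for every height `n` (the `∃`-before-the-height form of `hQa`).
[folklore] [cite: Balaban1985BackgroundPropagators, (3.15)–(3.16) p.393, Thm 3.1 (3.42) p.397, (3.49) p.399; Balaban1985Averaging, (126) p.36] -/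
theorem norm_block_adjoint_QkW_le_heightFree (hm : ∀ i, 1 ≤ m i) {κ : ℝ} (hκ : 0 ≤ κ) (hα0 : ∀ j, 0 ≤ α j) {A : ℝ}
    (hA : ∑ j ∈ Finset.range (n + 1), α j ≤ A) (u v : TSite d m) :
    ‖PB v ∘L LinearMap.toContinuousLinearMap (LinearMap.adjoint (QkW L m n φ U hL α hα1 hU1 hreg (c₀ := c₀) (c₁ := c₁))) ∘L rF u‖ ≤
      Mφ' * Mφ * Real.exp (50 * (d + 1) * A) * Real.exp κ * Real.sqrt (d * c₁) / Real.sqrt c₀ * Real.exp (-(κ * tdist m u v)) := by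
  have hc₀ : 0 < c₀ := Fact.out
  refine (norm_block_adjoint_QkW_le L m n φ U hL α hα1 hU1 hreg hφ hφ' hMφ hMφ' hPB hrF hm hκ hα0 u v).trans ?_
  have hP := prod_level_le_exp (d := d) n α hα0 hA
  have hnn : 0 ≤ Mφ' * Mφ := mul_nonneg hMφ' hMφ
  have h2 : 0 ≤ Real.exp κ * Real.sqrt (d * c₁) / Real.sqrt c₀ * Real.exp (-(κ * tdist m u v)) := by positivity
  calc Mφ' * Mφ * (∏ j ∈ Finset.range (n + 1), (1 + 50 * (d + 1) * α j)) * Real.exp κ * Real.sqrt (d * c₁) / Real.sqrt c₀ *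
        Real.exp (-(κ * tdist m u v))
      = (Mφ' * Mφ) * (∏ j ∈ Finset.range (n + 1), (1 + 50 * (d + 1) * α j)) *
          (Real.exp κ * Real.sqrt (d * c₁) / Real.sqrt c₀ * Real.exp (-(κ * tdist m u v))) := by ring
    _ ≤ (Mφ' * Mφ) * Real.exp (50 * (d + 1) * A) * (Real.exp κ * Real.sqrt (d * c₁) / Real.sqrt c₀ * Real.exp (-(κ * tdist m u v))) := by
        gcongr
    _ = Mφ' * Mφ * Real.exp (50 * (d + 1) * A) * Real.exp κ * Real.sqrt (d * c₁) / Real.sqrt c₀ * Real.exp (-(κ * tdist m u v)) := by ring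

end Tower

end Literature.MathematicalPhysics.QuantumFieldTheory.Balaban1983to89.B9Eq315QAdjointBlockDecay

end
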